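import Mathlib
import Literature.LinearAlgebra.Matrix.CauchyDeterminant
import Summits.ValiantsHypothesis.ValiantsHypothesis.Theses.BarrierLever

/-!
# Route BarrierLever — item `ResultantKernelSufficesForTransversal` (stmt-ValiantsHypothesis-19180):
# the arrow CT ⇒ TT (Cauchy specialisation of the transversal-minor conjecture)

**Setting (cell valiant-natproofs, rung V4, 𝒟-side of FSV Question 6; planner p1 gen 8).** For
`u, w ⊆ Fin h` the ROW TRANSVERSAL `ρ_u : Fin h → Fin (h+h)` picks `a` if `a ∈ u` and `h + a`
otherwise, the COLUMN TRANSVERSAL `τ_w` picks `h + c` if `c ∈ w` and `c` otherwise. Conjecture TT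
(`TransversalMinorLayoutsNonsingular`, stmt-19152): for every square layout `(u_i)_i, (w_j)_j`
(injective families) some `H ∈ ℂ^{(h+h)×(h+h)}` makes `(det H[ρ_{u_i}, τ_{w_j}])_{i,j}`
nonsingular. Conjecture CT (`TransversalResultantKernelNonsingular`, stmt-19179): the same for the
RESULTANT KERNEL `M_{p,q}[u, w] = ∏_{a,c} (p (ρ_u a) - q (τ_w c))`, `p, q ∈ ℂ^{h+h}` (`4h`
parameters).

**Theorem (`transversal_of_resultantKernel`): CT ⇒ TT.** Given a layout `(u, w)`, apply CT to the
COMPLEMENTED layout `(u, wᶜ)`; the layout determinant of `M_{p,q}` is then a nonzero polynomial in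
`(p, q)`, so (`exists_injective_eval_ne_zero`, `MvPolynomial.funext` over the infinite field `ℂ`) it
is nonzero at some point with ALL `2(h+h)` coordinates `p_i, q_j` distinct. Put
`H[i, j] := (p_i - q_j)⁻¹`. By Cauchy's double alternant (tree
`Literature.LinearAlgebra.Matrix.det_cauchyMatrix`)
`det H[ρ_u, τ_w] = V(p ∘ ρ_u) · V'(q ∘ τ_w) / ∏_{a,c} (p (ρ_u a) - q (τ_w c))`
(`det_cauchy_submatrix_eq`, Vandermonde-type factors nonzero by injectivity), and since `τ_w c`,
`τ_{wᶜ} c` are the two columns `c, h + c` of the pair (`prod_pair_compl`),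
`∏_{a,c} (p (ρ_u a) - q (τ_w c)) · M_{p,q}[u, wᶜ] = ∏_a ∏_{all j} (p (ρ_u a) - q_j) =: R(u) ≠ 0`.
Hence the TT layout matrix of `H` is `diag(V(p∘ρ_{u_i}) / R(u_i)) · (M_{p,q}[u_i, w_jᶜ]) ·
diag(V'(q∘τ_{w_j}))`, nonsingular (`Matrix.det_mul_column`, `Matrix.det_mul_row`).

The last declaration `resultantKernelSufficesForTransversal` is the signature of item
stmt-ValiantsHypothesis-19180 VERBATIM; `transversalMinorLayoutsNonsingular_of_resultantKernel`
is the same arrow typed against the Theses decl `TransversalMinorLayoutsNonsingular` (stmt-19152).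

WHAT THIS IS NOT: conditional on CT (stmt-19179, OPEN: a 4h-parameter strengthening of TNS,
numerically clean for h ≤ 4); nothing unconditional about TT / TNS / `PartitionMinorsHitByVP`
(stmt-19717), nothing on FSV Question 6 / crux stmt-14610 or `VP` vs `VNP`.

References: A.-L. Cauchy (1841) / [Krattenthaler1999] eq. (2.7) (double alternant); N. Nisan,
STOC 1991 (partition matrices); [ForbesShpilkaVolk2018] Question 6.
-/

-- layout Summits/ValiantsHypothesis/ValiantsHypothesis forces the duplicated namespace component
set_option linter.dupNamespace false

open MvPolynomial Finset

namespace Summit.ValiantsHypothesis.ValiantsHypothesis.Theorems.BarrierLever.ResultantKernel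

/-! ## 1. Transversals -/

/-- The row transversal `ρ_u` (`a ↦ a` on `u`, `a ↦ h + a` off `u`) is injective. -/
theorem rowT_injective (h : ℕ) (u : Finset (Fin h)) :
    Function.Injective (fun a : Fin h => if a ∈ u then Fin.castAdd h a else Fin.natAdd h a) := by
  intro a a' haa'
  have hv := congrArg Fin.val haa'
  dsimp only at hv
  have ha0 := a.isLt
  have ha1 := a'.isLt
  apply Fin.ext
  by_cases ha : a ∈ u <;> by_cases ha' : a' ∈ u <;>
    simp only [ha, ha', if_true, if_false, Fin.val_castAdd, Fin.val_natAdd] at hv <;> omega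

/-- The column transversal `τ_w` (`c ↦ h + c` on `w`, `c ↦ c` off `w`) is injective. -/
theorem colT_injective (h : ℕ) (w : Finset (Fin h)) :
    Function.Injective (fun c : Fin h => if c ∈ w then Fin.natAdd h c else Fin.castAdd h c) := by
  intro c c' hcc'
  have hv := congrArg Fin.val hcc'
  dsimp only at hv
  have hc0 := c.isLt
  have hc1 := c'.isLt
  apply Fin.ext
  by_cases hc : c ∈ w <;> by_cases hc' : c' ∈ w <;>
    simp only [hc, hc', if_true, if_false, Fin.val_castAdd, Fin.val_natAdd] at hv <;> omega

/-- For each column pair `c`, the columns chosen by `w` and by `wᶜ` are the two columns `c`,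
`h + c` of the pair: `f (τ_w c) · f (τ_{wᶜ} c) = f c · f (h + c)`. -/
theorem pair_mul_compl {α : Type*} [CommMonoid α] (h : ℕ) (w : Finset (Fin h))
    (f : Fin (h + h) → α) (c : Fin h) :
    f (if c ∈ w then Fin.natAdd h c else Fin.castAdd h c) *
        f (if c ∈ wᶜ then Fin.natAdd h c else Fin.castAdd h c)
      = f (Fin.castAdd h c) * f (Fin.natAdd h c) := by
  by_cases hc : c ∈ w
  · rw [if_pos hc, if_neg (fun h' => (Finset.mem_compl.1 h') hc), mul_comm]
  · rw [if_neg hc, if_pos (Finset.mem_compl.2 hc)]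

/-- **Complement identity**: `∏_c f (τ_w c) · ∏_c f (τ_{wᶜ} c) = ∏_{j < h+h} f j`. -/
theorem prod_pair_compl {α : Type*} [CommMonoid α] (h : ℕ) (w : Finset (Fin h))
    (f : Fin (h + h) → α) :
    (∏ c : Fin h, f (if c ∈ w then Fin.natAdd h c else Fin.castAdd h c)) *
        ∏ c : Fin h, f (if c ∈ wᶜ then Fin.natAdd h c else Fin.castAdd h c)
      = ∏ j : Fin (h + h), f j := by
  calc (∏ c : Fin h, f (if c ∈ w then Fin.natAdd h c else Fin.castAdd h c)) *
        ∏ c : Fin h, f (if c ∈ wᶜ then Fin.natAdd h c else Fin.castAdd h c)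
        = ∏ c : Fin h, (f (Fin.castAdd h c) * f (Fin.natAdd h c)) := by
          rw [← Finset.prod_mul_distrib]
          exact Finset.prod_congr rfl fun c _ => pair_mul_compl h w f c
    _ = (∏ c : Fin h, f (Fin.castAdd h c)) * ∏ c : Fin h, f (Fin.natAdd h c) :=
          Finset.prod_mul_distrib
    _ = ∏ j : Fin (h + h), f j := (Fin.prod_univ_add f).symm

/-! ## 2. Cauchy's double alternant on transversal (indeed arbitrary) `h × h` minors -/

/-- **Cauchy minors.** For `p, q ∈ ℂ^{h+h}` with `p_i ≠ q_j` throughout there are functions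
`V, V'` of the row resp. column selection alone, NONZERO on injective selections when `p` resp.
`q` is injective (Vandermonde-type products), with
`det ((p (ρ a) - q (τ c))⁻¹)_{a,c} = V ρ · V' τ / ∏_{a,c} (p (ρ a) - q (τ c))`
(the tree's `det_cauchyMatrix`, reindexed from `ℕ`-sequences to `Fin h`). -/
theorem det_cauchy_submatrix_eq {h : ℕ} (p q : Fin (h + h) → ℂ) (hpq : ∀ i j, p i ≠ q j) :
    ∃ V V' : (Fin h → Fin (h + h)) → ℂ,
      (∀ ρ, Function.Injective ρ → Function.Injective p → V ρ ≠ 0) ∧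
      (∀ τ, Function.Injective τ → Function.Injective q → V' τ ≠ 0) ∧
      ∀ ρ τ : Fin h → Fin (h + h),
        ((Matrix.of fun i j : Fin (h + h) => (p i - q j)⁻¹).submatrix ρ τ).det
          = V ρ * V' τ / ∏ a : Fin h, ∏ c : Fin h, (p (ρ a) - q (τ c)) := by
  refine ⟨fun ρ => ∏ j ∈ range h, ∏ i ∈ range j,
      ((if hn : j < h then p (ρ ⟨j, hn⟩) else 0) - (if hn : i < h then p (ρ ⟨i, hn⟩) else 0)),
    fun τ => ∏ j ∈ range h, ∏ i ∈ range j,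
      ((if hn : i < h then q (τ ⟨i, hn⟩) else 0) - (if hn : j < h then q (τ ⟨j, hn⟩) else 0)),
    ?_, ?_, ?_⟩
  · intro ρ hρ hp
    refine Finset.prod_ne_zero_iff.2 fun j hj => Finset.prod_ne_zero_iff.2 fun i hi => ?_
    have hjh : j < h := Finset.mem_range.1 hj
    have hij : i < j := Finset.mem_range.1 hi
    have hih : i < h := hij.trans hjh
    rw [dif_pos hjh, dif_pos hih, sub_ne_zero]
    intro h0
    have h1 := congrArg Fin.val (hρ (hp h0))
    simp only at h1
    omega
  · intro τ hτ hq
    refine Finset.prod_ne_zero_iff.2 fun j hj => Finset.prod_ne_zero_iff.2 fun i hi => ?_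
    have hjh : j < h := Finset.mem_range.1 hj
    have hij : i < j := Finset.mem_range.1 hi
    have hih : i < h := hij.trans hjh
    rw [dif_pos hjh, dif_pos hih, sub_ne_zero]
    intro h0
    have h1 := congrArg Fin.val (hτ (hq h0))
    simp only at h1
    omega
  · intro ρ τ
    set x : ℕ → ℂ := fun n => if hn : n < h then p (ρ ⟨n, hn⟩) else 0 with hx
    set y : ℕ → ℂ := fun n => if hn : n < h then q (τ ⟨n, hn⟩) else 0 with hy
    have hxa : ∀ a : Fin h, x a = p (ρ a) := fun a => by simp [hx, a.isLt]
    have hyc : ∀ c : Fin h, y c = q (τ c) := fun c => by simp [hy, c.isLt]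
    have hM : (Matrix.of fun i j : Fin (h + h) => (p i - q j)⁻¹).submatrix ρ τ =
        Literature.LinearAlgebra.Matrix.cauchyMatrix x y h := by
      ext a c
      rw [Matrix.submatrix_apply, Matrix.of_apply, Literature.LinearAlgebra.Matrix.cauchyMatrix_apply,
        hxa, hyc]
    have hxy : ∀ i j : ℕ, i < h → j < h → x i ≠ y j := by
      intro i j hi hj
      rw [show x i = p (ρ ⟨i, hi⟩) from hxa ⟨i, hi⟩, show y j = q (τ ⟨j, hj⟩) from hyc ⟨j, hj⟩]
      exact hpq _ _
    rw [hM, Literature.LinearAlgebra.Matrix.det_cauchyMatrix x y h hxy]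
    congr 1
    · simp_rw [Finset.prod_mul_distrib]
      rfl
    · rw [← Fin.prod_univ_eq_prod_range]
      refine Finset.prod_congr rfl fun a _ => ?_
      rw [← Fin.prod_univ_eq_prod_range]
      refine Finset.prod_congr rfl fun c _ => ?_
      rw [hxa, hyc]

/-! ## 3. Zariski genericity: a nonzero polynomial over `ℂ` is nonzero at an injective point -/

/-- A nonzero polynomial over `ℂ` does not vanish identically (`MvPolynomial.funext`). -/
theorem exists_eval_ne_zero {σ : Type*} {F : MvPolynomial σ ℂ} (hF : F ≠ 0) :
    ∃ v : σ → ℂ, eval v F ≠ 0 := by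
  by_contra hcon
  push Not at hcon
  exact hF (MvPolynomial.funext fun v => by rw [hcon v, map_zero])

/-- A nonzero polynomial over `ℂ` in finitely many variables is nonzero at a point all of whose
coordinates are DISTINCT (multiply by the discriminant-type product `∏_{s ≠ t} (X_s - X_t)`). -/
theorem exists_injective_eval_ne_zero {σ : Type*} [Fintype σ] [DecidableEq σ]
    {G : MvPolynomial σ ℂ} (hG : G ≠ 0) :
    ∃ v : σ → ℂ, Function.Injective v ∧ eval v G ≠ 0 := by
  set Δ : MvPolynomial σ ℂ := ∏ s, ∏ t, (if s = t then 1 else (X s - X t)) with hΔ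
  have hΔ0 : Δ ≠ 0 := by
    refine Finset.prod_ne_zero_iff.2 fun s _ => Finset.prod_ne_zero_iff.2 fun t _ => ?_
    split_ifs with hst
    · exact one_ne_zero
    · intro h0
      have h1 := congrArg (MvPolynomial.coeff (Finsupp.single s 1)) h0
      rw [coeff_sub, coeff_X_same, coeff_X, if_neg (fun h' => hst
        ((Finsupp.single_left_inj one_ne_zero).1 h').symm), coeff_zero, sub_zero] at h1
      exact one_ne_zero h1
  obtain ⟨v, hv⟩ := exists_eval_ne_zero (mul_ne_zero hG hΔ0)
  rw [map_mul] at hv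
  refine ⟨v, fun s t hst => ?_, left_ne_zero_of_mul hv⟩
  by_contra hne
  refine (right_ne_zero_of_mul hv) ?_
  rw [hΔ, map_prod]
  refine Finset.prod_eq_zero (Finset.mem_univ s) ?_
  rw [map_prod]
  refine Finset.prod_eq_zero (Finset.mem_univ t) ?_
  rw [if_neg hne, map_sub, eval_X, eval_X, hst, sub_self]

/-! ## 4. CT ⇒ TT -/

/-- **CT ⇒ TT, one layout at a time.** From CT for the complemented layout `(u, wᶜ)` to TT for
`(u, w)`, with the Cauchy matrix `H = ((p_i - q_j)⁻¹)` at a generic point `(p, q)`. -/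
theorem transversal_of_resultantKernel
    (hCT : ∀ (h r : ℕ) (u w : Fin r → Finset (Fin h)), Function.Injective u →
      Function.Injective w → ∃ p q : Fin (h + h) → ℂ, (Matrix.of fun i j : Fin r =>
        ∏ a : Fin h, ∏ c : Fin h, (p (if a ∈ u i then Fin.castAdd h a else Fin.natAdd h a)
          - q (if c ∈ w j then Fin.natAdd h c else Fin.castAdd h c))).det ≠ 0)
    (h r : ℕ) (u w : Fin r → Finset (Fin h)) (hu : Function.Injective u)
    (hw : Function.Injective w) :
    ∃ H : Matrix (Fin (h + h)) (Fin (h + h)) ℂ, (Matrix.of fun i j : Fin r =>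
      (H.submatrix (fun a : Fin h => if a ∈ u i then Fin.castAdd h a else Fin.natAdd h a)
        (fun c : Fin h => if c ∈ w j then Fin.natAdd h c else Fin.castAdd h c)).det).det ≠ 0 := by
  classical
  -- Step 1: CT for the complemented layout `(u, wᶜ)`, as a nonzero polynomial in `(p, q)`
  have hwc : Function.Injective (fun j => (w j)ᶜ) := fun j j' hjj' => hw (compl_injective hjj')
  obtain ⟨p₀, q₀, h0⟩ := hCT h r u (fun j => (w j)ᶜ) hu hwc
  set G : MvPolynomial (Fin (h + h) ⊕ Fin (h + h)) ℂ := (Matrix.of fun i j : Fin r =>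
      ∏ a : Fin h, ∏ c : Fin h,
        (X (Sum.inl (if a ∈ u i then Fin.castAdd h a else Fin.natAdd h a))
          - X (Sum.inr (if c ∈ (w j)ᶜ then Fin.natAdd h c else Fin.castAdd h c)) :
            MvPolynomial (Fin (h + h) ⊕ Fin (h + h)) ℂ)).det with hG
  have hevalG : ∀ v : Fin (h + h) ⊕ Fin (h + h) → ℂ, eval v G = (Matrix.of fun i j : Fin r =>
      ∏ a : Fin h, ∏ c : Fin h,
        (v (Sum.inl (if a ∈ u i then Fin.castAdd h a else Fin.natAdd h a))
          - v (Sum.inr (if c ∈ (w j)ᶜ then Fin.natAdd h c else Fin.castAdd h c)))).det := by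
    intro v
    rw [hG, RingHom.map_det]
    congr 1
    ext i j
    simp only [RingHom.mapMatrix_apply, Matrix.map_apply, Matrix.of_apply, map_prod, map_sub,
      eval_X]
  have hG0 : G ≠ 0 := by
    intro hz
    apply h0
    have h1 := hevalG (Sum.elim p₀ q₀)
    rw [hz, map_zero] at h1
    simp only [Sum.elim_inl, Sum.elim_inr] at h1
    exact h1.symm
  obtain ⟨v, hvinj, hvG⟩ := exists_injective_eval_ne_zero hG0
  rw [hevalG] at hvG
  -- the generic parameters: all `p_i, q_j` distinct
  set p : Fin (h + h) → ℂ := fun i => v (Sum.inl i) with hp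
  set q : Fin (h + h) → ℂ := fun j => v (Sum.inr j) with hq
  have hpq : ∀ i j, p i ≠ q j := fun i j hij => Sum.inl_ne_inr (hvinj hij)
  have hpinj : Function.Injective p := fun i i' h' => Sum.inl_injective (hvinj h')
  have hqinj : Function.Injective q := fun j j' h' => Sum.inr_injective (hvinj h')
  -- Step 2: the Cauchy matrix at `(p, q)`
  refine ⟨Matrix.of fun i j : Fin (h + h) => (p i - q j)⁻¹, ?_⟩
  obtain ⟨V, V', hV, hV', hdet⟩ := det_cauchy_submatrix_eq p q hpq
  -- abbreviations: row factors, column factors, the CT matrix of the complemented layout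
  set d₁ : Fin r → ℂ := fun i =>
    V (fun a : Fin h => if a ∈ u i then Fin.castAdd h a else Fin.natAdd h a) /
      ∏ a : Fin h, ∏ jj : Fin (h + h),
        (p (if a ∈ u i then Fin.castAdd h a else Fin.natAdd h a) - q jj) with hd₁
  set d₂ : Fin r → ℂ := fun j =>
    V' (fun c : Fin h => if c ∈ w j then Fin.natAdd h c else Fin.castAdd h c) with hd₂
  set Mc : Fin r → Fin r → ℂ := fun i j =>
    ∏ a : Fin h, ∏ c : Fin h, (p (if a ∈ u i then Fin.castAdd h a else Fin.natAdd h a)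
      - q (if c ∈ (w j)ᶜ then Fin.natAdd h c else Fin.castAdd h c)) with hMc
  -- Step 3: entrywise, `det H[ρ_{u_i}, τ_{w_j}] = d₁ i * (Mc i j * d₂ j)`
  have hentry : ∀ i j : Fin r,
      ((Matrix.of fun i j : Fin (h + h) => (p i - q j)⁻¹).submatrix
          (fun a : Fin h => if a ∈ u i then Fin.castAdd h a else Fin.natAdd h a)
          (fun c : Fin h => if c ∈ w j then Fin.natAdd h c else Fin.castAdd h c)).det
        = d₁ i * (Mc i j * d₂ j) := by
    intro i j
    rw [hdet]
    have hR : (∏ a : Fin h, ∏ c : Fin h, (p (if a ∈ u i then Fin.castAdd h a else Fin.natAdd h a)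
          - q (if c ∈ w j then Fin.natAdd h c else Fin.castAdd h c))) * Mc i j
        = ∏ a : Fin h, ∏ jj : Fin (h + h),
            (p (if a ∈ u i then Fin.castAdd h a else Fin.natAdd h a) - q jj) := by
      rw [hMc, ← Finset.prod_mul_distrib]
      exact Finset.prod_congr rfl fun a _ => prod_pair_compl h (w j)
        (fun jj => p (if a ∈ u i then Fin.castAdd h a else Fin.natAdd h a) - q jj)
    have hR0 : ∏ a : Fin h, ∏ jj : Fin (h + h),
        (p (if a ∈ u i then Fin.castAdd h a else Fin.natAdd h a) - q jj) ≠ 0 :=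
      Finset.prod_ne_zero_iff.2 fun a _ => Finset.prod_ne_zero_iff.2 fun jj _ =>
        sub_ne_zero.2 (hpq _ _)
    have hD0 : ∏ a : Fin h, ∏ c : Fin h, (p (if a ∈ u i then Fin.castAdd h a else Fin.natAdd h a)
          - q (if c ∈ w j then Fin.natAdd h c else Fin.castAdd h c)) ≠ 0 :=
      Finset.prod_ne_zero_iff.2 fun a _ => Finset.prod_ne_zero_iff.2 fun c _ =>
        sub_ne_zero.2 (hpq _ _)
    have hMc0 : Mc i j ≠ 0 := by
      intro hz
      rw [hz, mul_zero] at hR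
      exact hR0 hR.symm
    rw [hd₁, hd₂]
    simp only
    rw [← hR]
    field_simp
  -- Step 4: the layout determinant factors
  have hmat : (Matrix.of fun i j : Fin r =>
      ((Matrix.of fun i j : Fin (h + h) => (p i - q j)⁻¹).submatrix
          (fun a : Fin h => if a ∈ u i then Fin.castAdd h a else Fin.natAdd h a)
          (fun c : Fin h => if c ∈ w j then Fin.natAdd h c else Fin.castAdd h c)).det)
      = Matrix.of fun i j : Fin r => d₁ i * (Mc i j * d₂ j) := by
    ext i j
    exact hentry i j
  have h1 : (Matrix.of fun i j : Fin r => d₁ i * (Mc i j * d₂ j)).det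
      = (∏ i, d₁ i) * (Matrix.of fun i j : Fin r => Mc i j * d₂ j).det :=
    Matrix.det_mul_column d₁ (Matrix.of fun i j : Fin r => Mc i j * d₂ j)
  have h2 : (Matrix.of fun i j : Fin r => Mc i j * d₂ j).det
      = (∏ j, d₂ j) * (Matrix.of fun i j : Fin r => Mc i j).det := by
    rw [← Matrix.det_mul_row d₂ (Matrix.of fun i j : Fin r => Mc i j)]
    congr 1
    ext i j
    simp only [Matrix.of_apply, mul_comm]
  rw [hmat, h1, h2]
  have hd₁0 : ∀ i, d₁ i ≠ 0 := fun i =>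
    div_ne_zero (hV _ (rowT_injective h (u i)) hpinj)
      (Finset.prod_ne_zero_iff.2 fun a _ => Finset.prod_ne_zero_iff.2 fun jj _ =>
        sub_ne_zero.2 (hpq _ _))
  have hd₂0 : ∀ j, d₂ j ≠ 0 := fun j => hV' _ (colT_injective h (w j)) hqinj
  refine mul_ne_zero (Finset.prod_ne_zero_iff.2 fun i _ => hd₁0 i)
    (mul_ne_zero (Finset.prod_ne_zero_iff.2 fun j _ => hd₂0 j) ?_)
  exact hvG

/-- **Item `ResultantKernelSufficesForTransversal` (stmt-ValiantsHypothesis-19180), signature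
verbatim:** CT (`TransversalResultantKernelNonsingular`, stmt-19179, inlined) ⇒ TT
(`TransversalMinorLayoutsNonsingular`, stmt-19152, inlined). -/
theorem resultantKernelSufficesForTransversal :
    (∀ (h r : ℕ) (u w : Fin r → Finset (Fin h)), Function.Injective u → Function.Injective w → ∃ p q : Fin (h + h) → ℂ, (Matrix.of fun i j : Fin r => ∏ a : Fin h, ∏ c : Fin h, (p (if a ∈ u i then Fin.castAdd h a else Fin.natAdd h a) - q (if c ∈ w j then Fin.natAdd h c else Fin.castAdd h c))).det ≠ 0) → (∀ (h r : ℕ) (u w : Fin r → Finset (Fin h)), Function.Injective u → Function.Injective w → ∃ H : Matrix (Fin (h + h)) (Fin (h + h)) ℂ, (Matrix.of fun i j : Fin r => (H.submatrix (fun a : Fin h => if a ∈ u i then Fin.castAdd h a else Fin.natAdd h a) (fun c : Fin h => if c ∈ w j then Fin.natAdd h c else Fin.castAdd h c)).det).det ≠ 0) :=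
  fun hCT h r u w hu hw => transversal_of_resultantKernel hCT h r u w hu hw

/-- The same arrow typed against the route decl: CT ⇒ `TransversalMinorLayoutsNonsingular`
(stmt-ValiantsHypothesis-19152). -/
theorem transversalMinorLayoutsNonsingular_of_resultantKernel
    (hCT : ∀ (h r : ℕ) (u w : Fin r → Finset (Fin h)), Function.Injective u →
      Function.Injective w → ∃ p q : Fin (h + h) → ℂ, (Matrix.of fun i j : Fin r =>
        ∏ a : Fin h, ∏ c : Fin h, (p (if a ∈ u i then Fin.castAdd h a else Fin.natAdd h a)
          - q (if c ∈ w j then Fin.natAdd h c else Fin.castAdd h c))).det ≠ 0) :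
    Summit.ValiantsHypothesis.ValiantsHypothesis.Theses.BarrierLever.TransversalMinorLayoutsNonsingular :=
  fun h r u w hu hw => transversal_of_resultantKernel hCT h r u w hu hw

end Summit.ValiantsHypothesis.ValiantsHypothesis.Theorems.BarrierLever.ResultantKernel
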